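import Summits.AtomisticToContinuum.FouriersLaw.Theorems.PhononMeanFreePathIncoherentChannelResamplePoincare
import Summits.AtomisticToContinuum.FouriersLaw.Theorems.PhononMeanFreePathIncoherentChannelTimeResolvedBudgetHelper1

/-!
# The left-sensitivity budget of the forecasts (line `two-horizons-forecast-loss`)

Helper file of line `two-horizons-forecast-loss` of crux `PhononMeanFreePath.IncoherentChannel`
(stmt-AtomisticToContinuum-11811), registered stub `leftSensitivity_budget_smooth`.

Setting: `P = pinnedChain ω₂ lam β γ`, the `(N+1)`-site anharmonic chain with Langevin baths at sites `0` and
`N`, both at temperature `T > 0`; `μ₀ = P.gibbsMeasure (N+1) T`, `K_s = P.transitionKernel (N+1) T T s⁺`,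
`ν = gaussianReal 0 T`. For `x = (z, σ) ∈ Ω × ℝ` the RESAMPLED state is `z̃ = (z.1, z.2[0 ↦ σ])` (the near-bath
momentum `p_0` replaced by a fresh Gaussian sample). For a test observable `F ∈ C_c(Ω)` with forecasts
`u_s = K_s F`, the `N`-UNIFORM left-sensitivity budget

  `∫_{0<s≤t} ∫ (u_s(z) − u_s(z̃))² d(μ₀ ⊗ ν) ds ≤ (π²/(8γ)) ∫ F² dμ₀`   (lower Lebesgue integrals, in `[0, ∞]`).

Proof: the composition of two landed inequalities. For each `s > 0` the forecast `u_s` is `C²`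
(`IncoherentBounded.contDiff_forecast`, hypoellipticity), so the one-coordinate fibre Poincaré inequality
`resamplePoincare_zero` gives `∫ (u_s(z) − u_s(z̃))² d(μ₀ ⊗ ν) ≤ (π²/4)·T·∫ (∂_{p_0} u_s)² dμ₀`; keeping only the
`i = 0` term of the carré du champ `2γ ∑_i ([i=0]T + [i=N]T)(∂_{p_i} u_s)²` (`sum_bathWeight_mul_eq`) bounds
`∫ (∂_{p_0} u_s)² dμ₀` by `(2γT)⁻¹ ∫ 2Γ(u_s) dμ₀`, and the time-resolved dissipation inequality
`dissipation_lintegral_le_timeResolved` (`‖u_t‖² + ∫_{0<s≤t} ∫ 2Γ(u_s) dμ₀ ds ≤ ∫ F² dμ₀`, its first term dropped)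
integrates this over `s ∈ (0, t]`; the constants combine to `(π²/4)·T·(2γT)⁻¹ = π²/(8γ)`. Everything is an
inequality of lower Lebesgue integrals; no integrability or measurability is needed. [folklore]
-/

noncomputable section

namespace Summit.AtomisticToContinuum.FouriersLaw.Theorems.PhononMeanFreePath

open MeasureTheory Set Filter Topology ProbabilityTheory
open scoped NNReal ENNReal
open Literature.MathematicalPhysics.KineticTheory.HeatConduction
open Summit.AtomisticToContinuum.FouriersLaw.Theorems.IncoherentBounded

/-- **Keeping only the near-bath term of the carré du champ, in `ℝ≥0∞`.** On the `(N+1)`-site chain with both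
baths at `T > 0` and friction `γ > 0`, for every `f` and every microstate `x`,
`(∂_{p_0} f)²(x) ≤ (2γT)⁻¹ · 2γ ∑_i ([i=0]T + [i=N]T)(∂_{p_i} f)²(x)`: the bath-weighted sum collapses to
`T(∂_{p_0} f)² + T(∂_{p_N} f)²` (`sum_bathWeight_mul_eq`) and the second term is nonnegative. [folklore] -/
theorem ofReal_partialP_zero_sq_le_bathWeight {N : ℕ} {T γ : ℝ} (hT : 0 < T) (hγ : 0 < γ)
    (f : PhaseSpace (N + 1) → ℝ) (x : PhaseSpace (N + 1)) :
    ENNReal.ofReal (partialP 0 f x ^ 2) ≤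
      ENNReal.ofReal (1 / (2 * γ * T)) * ENNReal.ofReal (2 * (γ * ∑ i : Fin (N + 1),
        ((if i.val = 0 then T else 0) + (if i.val = N + 1 - 1 then T else 0)) * partialP i f x ^ 2)) := by
  rw [← ENNReal.ofReal_mul (by positivity), sum_bathWeight_mul_eq N T (fun i => partialP i f x ^ 2)]
  refine ENNReal.ofReal_le_ofReal ?_
  have hne : 2 * γ * T ≠ 0 := by positivity
  have h0 : 0 ≤ T * partialP (Fin.last N) f x ^ 2 := by positivity
  calc partialP 0 f x ^ 2 = 1 / (2 * γ * T) * (2 * (γ * (T * partialP 0 f x ^ 2))) := by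
        rw [show 2 * (γ * (T * partialP 0 f x ^ 2)) = 2 * γ * T * partialP 0 f x ^ 2 by ring, one_div,
          inv_mul_cancel_left₀ hne]
    _ ≤ 1 / (2 * γ * T) * (2 * (γ * (T * partialP 0 f x ^ 2 + T * partialP (Fin.last N) f x ^ 2))) := by
        gcongr
        exact le_add_of_nonneg_right h0

/-- **Resampling sensitivity is paid by the dissipation, pointwise in time.** For the pinned chain
`P = pinnedChain ω₂ lam β γ` (`ω₂ > 0`, `lam, β ≥ 0`, `γ > 0`), `T > 0`, `N + 1` sites, `μ₀ = P.gibbsMeasure (N+1) T`,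
`ν = 𝒩(0, T)` and `f ∈ C¹`:
`∫ (f(z) − f(q, p[0 ↦ σ]))² d(μ₀ ⊗ ν)(z, σ) ≤ (π²/(8γ)) ∫ 2γ ∑_i ([i=0]T + [i=N]T)(∂_{p_i} f)² dμ₀` in `[0, ∞]`
— the fibre Poincaré inequality `resamplePoincare_zero` (constant `(π²/4)T`) followed by
`ofReal_partialP_zero_sq_le_bathWeight` (constant `(2γT)⁻¹`) under the integral; `(π²/4)T(2γT)⁻¹ = π²/(8γ)`.
[folklore] -/
theorem lintegral_resample_sq_le_bathWeight {ω₂ lam β γ : ℝ} (hω : 0 < ω₂) (hl : 0 ≤ lam) (hβ : 0 ≤ β)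
    (hγ : 0 < γ) {T : ℝ} (hT : 0 < T) (N : ℕ) {f : PhaseSpace (N + 1) → ℝ} (hf : ContDiff ℝ 1 f) :
    ∫⁻ x : PhaseSpace (N + 1) × ℝ, ENNReal.ofReal ((f x.1 -
        f ((x.1.1, Function.update x.1.2 0 x.2) : PhaseSpace (N + 1))) ^ 2)
        ∂(((pinnedChain ω₂ lam β γ).gibbsMeasure (N + 1) T).prod (gaussianReal 0 T.toNNReal)) ≤
      ENNReal.ofReal (Real.pi ^ 2 / (8 * γ)) * ∫⁻ x, ENNReal.ofReal (2 * (γ * ∑ i : Fin (N + 1),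
        ((if i.val = 0 then T else 0) + (if i.val = N + 1 - 1 then T else 0)) * partialP i f x ^ 2))
        ∂((pinnedChain ω₂ lam β γ).gibbsMeasure (N + 1) T) := by
  have hconst : ENNReal.ofReal (Real.pi ^ 2 / 4 * T) * ENNReal.ofReal (1 / (2 * γ * T)) =
      ENNReal.ofReal (Real.pi ^ 2 / (8 * γ)) := by
    rw [← ENNReal.ofReal_mul (by positivity)]
    congr 1
    field_simp
    ring
  refine (resamplePoincare_zero ω₂ lam β γ hω hl hβ T hT N f hf).trans ?_
  rw [← hconst, mul_assoc, ← lintegral_const_mul' (ENNReal.ofReal (1 / (2 * γ * T))) _ ENNReal.ofReal_ne_top]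
  exact mul_le_mul_right (lintegral_mono fun x => ofReal_partialP_zero_sq_le_bathWeight hT hγ f x) _

/-- **The left-sensitivity budget of the forecasts (registered stub `leftSensitivity_budget_smooth`, line
`two-horizons-forecast-loss`).** For the pinned anharmonic chain `P = pinnedChain ω₂ lam β γ` on `N + 1` sites
(`ω₂, β, γ > 0`, `lam ≥ 0`) with both baths at `T > 0`, `μ₀ = P.gibbsMeasure (N+1) T`, `K_s` the constructed
kernels, `ν = 𝒩(0, T)`, a test observable `F ∈ C_c(Ω)` with forecasts `u_s = K_s F`, and the resampled state
`z̃ = (q, p[0 ↦ σ])`: for every horizon `t > 0`,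

  `∫_{0<s≤t} ∫ (u_s(z) − u_s(z̃))² d(μ₀ ⊗ ν)(z, σ) ds ≤ (π²/(8γ)) ∫ F² dμ₀`,

uniformly in `N`. Proof: for `s > 0`, `u_s ∈ C²` (`contDiff_forecast`) and `lintegral_resample_sq_le_bathWeight`
bounds the inner integral by `(π²/(8γ)) ∫ 2Γ(u_s) dμ₀`; integrate over `(0, t]` (`setLIntegral_mono'`,
`lintegral_const_mul'`) and use the time-resolved dissipation inequality `dissipation_lintegral_le_timeResolved`
with its `‖u_t‖²` term dropped. [folklore] -/
theorem leftSensitivity_budget_smooth : ∀ ω₂ lam β γ : ℝ, 0 < ω₂ → 0 ≤ lam → 0 < β → 0 < γ → ∀ T : ℝ, 0 < T → ∀ (N : ℕ) (F : PhaseSpace (N + 1) → ℝ), Continuous F → HasCompactSupport F → ∀ t : ℝ, 0 < t → ∫⁻ s in Ioc (0 : ℝ) t, (∫⁻ x : PhaseSpace (N + 1) × ℝ, ENNReal.ofReal (((∫ y, F y ∂((pinnedChain ω₂ lam β γ).transitionKernel (N + 1) T T s.toNNReal x.1)) - (∫ y, F y ∂((pinnedChain ω₂ lam β γ).transitionKernel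 (N + 1) T T s.toNNReal ((x.1.1, Function.update x.1.2 0 x.2) : PhaseSpace (N + 1))))) ^ 2) ∂(((pinnedChain ω₂ lam β γ).gibbsMeasure (N + 1) T).prod (ProbabilityTheory.gaussianReal 0 T.toNNReal))) ≤ ENNReal.ofReal (Real.pi ^ 2 / (8 * γ) * ∫ x, F x ^ 2 ∂((pinnedChain ω₂ lam β γ).gibbsMeasure (N + 1) T)) := by
  intro ω₂ lam β γ hω hl hβ hγ T hT N F hFc hFs t ht
  have hNp : 0 < N + 1 := Nat.succ_pos N
  -- the time-resolved dissipation inequality, its `‖K_t F‖²` term dropped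
  have hD : ∫⁻ s in Ioc (0 : ℝ) t, ∫⁻ x, ENNReal.ofReal (2 * (γ * ∑ i : Fin (N + 1),
      ((if i.val = 0 then T else 0) + (if i.val = N + 1 - 1 then T else 0)) *
        partialP i (fun z => ∫ y, F y ∂((pinnedChain ω₂ lam β γ).transitionKernel (N + 1) T T s.toNNReal z))
          x ^ 2)) ∂((pinnedChain ω₂ lam β γ).gibbsMeasure (N + 1) T) ≤
      ENNReal.ofReal (∫ x, F x ^ 2 ∂((pinnedChain ω₂ lam β γ).gibbsMeasure (N + 1) T)) :=
    le_add_self.trans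
      (dissipation_lintegral_le_timeResolved ω₂ lam β γ hω hl hβ hγ (N + 1) hNp T hT F hFc hFs t ht)
  -- the step at a fixed time `s > 0`: fibre Poincaré + the near-bath term of the carré du champ
  have hstep : ∀ s ∈ Ioc (0 : ℝ) t,
      ∫⁻ x : PhaseSpace (N + 1) × ℝ, ENNReal.ofReal
        (((∫ y, F y ∂((pinnedChain ω₂ lam β γ).transitionKernel (N + 1) T T s.toNNReal x.1)) -
          (∫ y, F y ∂((pinnedChain ω₂ lam β γ).transitionKernel (N + 1) T T s.toNNReal
            ((x.1.1, Function.update x.1.2 0 x.2) : PhaseSpace (N + 1))))) ^ 2)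
        ∂(((pinnedChain ω₂ lam β γ).gibbsMeasure (N + 1) T).prod (gaussianReal 0 T.toNNReal)) ≤
      ENNReal.ofReal (Real.pi ^ 2 / (8 * γ)) * ∫⁻ x, ENNReal.ofReal (2 * (γ * ∑ i : Fin (N + 1),
        ((if i.val = 0 then T else 0) + (if i.val = N + 1 - 1 then T else 0)) *
          partialP i (fun z => ∫ y, F y ∂((pinnedChain ω₂ lam β γ).transitionKernel (N + 1) T T s.toNNReal z))
            x ^ 2)) ∂((pinnedChain ω₂ lam β γ).gibbsMeasure (N + 1) T) := fun s hs =>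
    lintegral_resample_sq_le_bathWeight hω hl hβ.le hγ hT N
      ((contDiff_forecast hω hl hγ hNp hβ.le hT hT.le hFc hFs hs.1).of_le (by norm_num))
  -- integrate over `s ∈ (0, t]`
  calc _ ≤ ∫⁻ s in Ioc (0 : ℝ) t, ENNReal.ofReal (Real.pi ^ 2 / (8 * γ)) * ∫⁻ x, ENNReal.ofReal (2 * (γ *
          ∑ i : Fin (N + 1), ((if i.val = 0 then T else 0) + (if i.val = N + 1 - 1 then T else 0)) *
            partialP i (fun z => ∫ y, F y ∂((pinnedChain ω₂ lam β γ).transitionKernel (N + 1) T T s.toNNReal z))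
              x ^ 2)) ∂((pinnedChain ω₂ lam β γ).gibbsMeasure (N + 1) T) :=
        setLIntegral_mono' measurableSet_Ioc hstep
    _ = ENNReal.ofReal (Real.pi ^ 2 / (8 * γ)) * ∫⁻ s in Ioc (0 : ℝ) t, ∫⁻ x, ENNReal.ofReal (2 * (γ *
          ∑ i : Fin (N + 1), ((if i.val = 0 then T else 0) + (if i.val = N + 1 - 1 then T else 0)) *
            partialP i (fun z => ∫ y, F y ∂((pinnedChain ω₂ lam β γ).transitionKernel (N + 1) T T s.toNNReal z))
              x ^ 2)) ∂((pinnedChain ω₂ lam β γ).gibbsMeasure (N + 1) T) :=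
        lintegral_const_mul' _ _ ENNReal.ofReal_ne_top
    _ ≤ ENNReal.ofReal (Real.pi ^ 2 / (8 * γ)) *
          ENNReal.ofReal (∫ x, F x ^ 2 ∂((pinnedChain ω₂ lam β γ).gibbsMeasure (N + 1) T)) :=
        mul_le_mul_right hD _
    _ = ENNReal.ofReal (Real.pi ^ 2 / (8 * γ) * ∫ x, F x ^ 2 ∂((pinnedChain ω₂ lam β γ).gibbsMeasure (N + 1) T)) :=
        (ENNReal.ofReal_mul (by positivity)).symm

end Summit.AtomisticToContinuum.FouriersLaw.Theorems.PhononMeanFreePath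

end
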